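import Literature.MathematicalPhysics.QuantumLattice.HeatKernelGroupOperatorProofs
import Literature.RepresentationTheory.CompactGroups.TranslationFinite
import Literature.RepresentationTheory.CompactGroups.UnitaryTrick
import HarnessLib

/-!
# Peter–Weyl: finite-dimensional unitary representations of a compact group separate points

Topic `Literature/RepresentationTheory/CompactGroups`.  For a compact Hausdorff topological
group `G` and `g ≠ 1` there is a continuous unitary matrix representation
`σ : G →* U(n) ⊆ M_n(ℂ)` with `σ g ≠ 1` (T. Bröcker, T. tom Dieck, *Representations of Compact
Lie Groups* (1985), III (3.1) (Peter–Weyl: representative functions are dense) with III (4.1)–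
(4.2) (a compact group has a faithful representation iff it has finitely many … / compact Lie
groups have faithful representations); here the point-separation form, proved by the classical
`L²` argument of E. M. Stein, *Topics in Harmonic Analysis* (1970), Ch. II §2, and G. Folland,
*A Course in Abstract Harmonic Analysis* (1995), Thm. 5.11).

The operator-theoretic input is already in the tree: for a continuous kernel `k` on `G` the
convolution operator `T_k f = k ⋆ f` on `L²(G)` (Haar probability measure) is compact, and
symmetric for symmetric `k` (`isCompactOperator_convL2`, `convL2_isSymmetric`,
`Literature/MathematicalPhysics/QuantumLattice/HeatKernelGroupOperatorProofs.lean`), and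
Mathlib has the spectral theorem for compact self-adjoint operators
(`ContinuousLinearMap.orthogonalComplement_iSup_eigenspaces_eq_bot`,
`ContinuousLinearMap.finite_dimensional_eigenspace`).  We prove:

* `exists_symm_kernel_haarConv_sub_le` — **approximate identities**: for `u ∈ C(G)` and
  `ε > 0` a symmetric continuous kernel `k` with `‖k ⋆ u - u‖_∞ ≤ ε` (Urysohn bump at `1`,
  symmetrised and normalised; uniform continuity).
* `haarConv_mul_right_eq_of_forall_eigen` — if every continuous eigenfunction `v`
  (`k ⋆ v = c v`, `c ≠ 0`) of a symmetric kernel `k` is right-`g`-invariant, then so is `k ⋆ u`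
  for EVERY continuous `u` (the kernel translates `h ↦ k (x g h⁻¹) - k (x h⁻¹)` are orthogonal to
  all eigenspaces of `T_k`, hence zero by the spectral theorem).
* `exists_eigenfunction_not_invariant` — hence for `g ≠ 1` some continuous eigenfunction of
  some symmetric kernel is NOT right-`g`-invariant (otherwise `u (x g) = u x` for all continuous
  `u` by the approximate identity, contradicting Urysohn).
* `exists_rep_of_invariant_subspace` — a finite-dimensional subspace `W ⊆ C(G, ℝ)` invariant
  under right translations carries the continuous matrix representation
  `a ↦ [R_a|_W]` (`rTrans`, `TranslationFinite.lean`; matrix in a basis, complexified), which is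
  trivial at `g` only if `R_g = 1` on `W`; the eigenspaces `{v | k ⋆ v = c v}` (`c ≠ 0`) are such
  subspaces (`finiteDimensional_eigenfunctions`).
* **`exists_unitary_rep_apply_ne_one`** — the theorem: unitarise by Weyl's trick (`unitarize`,
  `UnitaryTrick.lean`).

Everything here is proved; there are no definitions and no named facts.

## References

* T. Bröcker, T. tom Dieck, *Representations of Compact Lie Groups*, GTM 98, Springer 1985,
  III (3.1), (4.1). [BrockerTomDieck1985]
* E. M. Stein, *Topics in Harmonic Analysis Related to the Littlewood–Paley Theory*, Annals of
  Math. Studies 63 (1970), Ch. II §2.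
* G. B. Folland, *A Course in Abstract Harmonic Analysis*, CRC 1995, §5.2 Thm. 5.11.
-/

noncomputable section

open MeasureTheory Filter Topology Set
open scoped InnerProductSpace
open Literature.MathematicalPhysics.QuantumFieldTheory (haarProbability)
open Literature.MathematicalPhysics.QuantumLattice

namespace Literature.RepresentationTheory.CompactGroups

namespace PeterWeyl

variable {G : Type*} [Group G] [TopologicalSpace G] [IsTopologicalGroup G] [CompactSpace G]

/-! ### Uniform continuity and continuity of right translation -/

/-- **Right uniform continuity on a compact group**: for continuous `u` and `ε > 0` there is a
neighbourhood `U` of `1` with `|u (x w) - u x| < ε` for all `w ∈ U` and all `x` (from the left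
version `exists_nhds_one_forall_abs_sub_lt` applied to `x ↦ u x⁻¹`). [folklore] -/
theorem exists_nhds_one_forall_abs_sub_lt_right {u : G → ℝ} (hu : Continuous u) {ε : ℝ}
    (hε : 0 < ε) : ∃ U ∈ 𝓝 (1 : G), ∀ w ∈ U, ∀ x, |u (x * w) - u x| < ε := by
  obtain ⟨U, hU, h⟩ := exists_nhds_one_forall_abs_sub_lt (k := fun x => u x⁻¹) (hu.comp continuous_inv) hε
  refine ⟨(fun w => w⁻¹) ⁻¹' U, ?_, fun w hw x => ?_⟩
  · have : Tendsto (fun w : G => w⁻¹) (𝓝 1) (𝓝 1) := by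
      simpa using (continuous_inv (G := G)).tendsto 1
    exact this hU
  · have := h w⁻¹ hw x⁻¹
    simpa [mul_inv_rev] using this

/-- **Right translation is continuous into `C(G, ℝ)`**: `a ↦ u(· a)` (`rTrans a u`) is continuous
for the uniform norm (right uniform continuity of `u`). [folklore] -/
theorem continuous_rTrans_apply [T2Space G] (u : C(G, ℝ)) : Continuous fun a : G => rTrans a u := by
  refine continuous_iff_continuousAt.2 fun a₀ => Metric.tendsto_nhds.2 fun ε hε => ?_
  obtain ⟨U, hU, h⟩ := exists_nhds_one_forall_abs_sub_lt_right u.continuous (half_pos hε)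
  have hc : Tendsto (fun a : G => a₀⁻¹ * a) (𝓝 a₀) (𝓝 1) := by
    have h := (continuous_const_mul a₀⁻¹).tendsto a₀
    rwa [inv_mul_cancel] at h
  filter_upwards [hc hU] with a ha
  refine (ContinuousMap.dist_lt_iff hε).2 fun x => ?_
  rw [rTrans_apply, rTrans_apply, Real.dist_eq]
  have := h (a₀⁻¹ * a) ha (x * a₀)
  rw [mul_assoc, mul_inv_cancel_left] at this
  linarith

/-! ### Approximate identities -/

section Haar

variable [MeasurableSpace G] [BorelSpace G]

/-- **Approximate identity by symmetric kernels.**  For `u ∈ C(G, ℝ)` and `ε > 0` there is a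
continuous symmetric kernel `k` (`k (y⁻¹) = k y`) with `|(k ⋆ u)(x) - u(x)| ≤ ε` for all `x`:
a Urysohn bump at `1` supported in a small symmetric neighbourhood, symmetrised and normalised
to `∫ k = 1`, so that `(k ⋆ u)(x) - u(x) = ∫ k(h) (u(h⁻¹ x) - u(x)) dh` (Folland 1995, Prop. 2.42;
Bröcker–tom Dieck III (3.3)). [folklore] -/
theorem exists_symm_kernel_haarConv_sub_le [T2Space G] (u : C(G, ℝ)) {ε : ℝ} (hε : 0 < ε) :
    ∃ k : C(G, ℝ), (∀ y, k y⁻¹ = k y) ∧ ∀ x, |haarConv k u x - u x| ≤ ε := by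
  -- uniform continuity: `|u (w x) - u x| < ε` for `w ∈ U`
  obtain ⟨U, hU, hUε⟩ := exists_nhds_one_forall_abs_sub_lt u.continuous hε
  -- an open neighbourhood `O ⊆ U ∩ U⁻¹` of `1`
  have hUinv : (fun w : G => w⁻¹) ⁻¹' U ∈ 𝓝 (1 : G) := by
    have : Tendsto (fun w : G => w⁻¹) (𝓝 1) (𝓝 1) := by
      simpa using (continuous_inv (G := G)).tendsto 1
    exact this hU
  obtain ⟨O, hOsub, hOopen, hO1⟩ := mem_nhds_iff.1 (inter_mem hU hUinv)
  -- Urysohn bump: `f 1 = 1`, `f = 0` off `O`, `0 ≤ f ≤ 1`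
  obtain ⟨f, hf0, hf1, hf01⟩ := exists_continuous_zero_one_of_isClosed hOopen.isClosed_compl
    (isClosed_singleton (x := (1 : G))) (disjoint_compl_left_iff.2 (singleton_subset_iff.2 hO1))
  -- symmetrise
  let k₁ : C(G, ℝ) := f + f.comp ⟨fun y => y⁻¹, continuous_inv⟩
  have hk₁_apply : ∀ y, k₁ y = f y + f y⁻¹ := fun y => rfl
  have hk₁_nonneg : ∀ y, 0 ≤ k₁ y := fun y => by
    rw [hk₁_apply]; exact add_nonneg (hf01 y).1 (hf01 _).1
  have hk₁_symm : ∀ y, k₁ y⁻¹ = k₁ y := fun y => by rw [hk₁_apply, hk₁_apply, inv_inv, add_comm]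
  have hk₁_one : k₁ 1 = 2 := by
    rw [hk₁_apply, inv_one, show f 1 = 1 from hf1 rfl]; norm_num
  have hk₁_supp : ∀ y, k₁ y ≠ 0 → y⁻¹ ∈ U := by
    intro y hy
    by_contra hyU
    have hyO : y ∉ O := fun h => hyU (hOsub h).2
    have hyO' : y⁻¹ ∉ O := fun h => hyU ((hOsub h).1)
    apply hy
    rw [hk₁_apply, show f y = 0 from hf0 hyO, show f y⁻¹ = 0 from hf0 hyO', add_zero]
  -- normalise
  have hI : 0 < ∫ y, k₁ y ∂haarProbability G :=
    k₁.continuous.integral_pos_of_hasCompactSupport_nonneg_nonzero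
      (HasCompactSupport.of_compactSpace _) hk₁_nonneg (by rw [hk₁_one]; norm_num)
  set I := ∫ y, k₁ y ∂haarProbability G with hI_def
  let k : C(G, ℝ) := I⁻¹ • k₁
  have hk_apply : ∀ y, k y = I⁻¹ * k₁ y := fun y => rfl
  have hk_nonneg : ∀ y, 0 ≤ k y := fun y => by
    rw [hk_apply]; exact mul_nonneg (inv_nonneg.2 hI.le) (hk₁_nonneg y)
  have hk_int : ∫ y, k y ∂haarProbability G = 1 := by
    simp only [hk_apply, integral_const_mul]
    exact inv_mul_cancel₀ hI.ne'
  have hint : ∀ {v : G → ℝ}, Continuous v → Integrable v (haarProbability G) := fun hv =>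
    hv.integrable_of_hasCompactSupport (HasCompactSupport.of_compactSpace _)
  refine ⟨k, fun y => by rw [hk_apply, hk_apply, hk₁_symm], fun x => ?_⟩
  -- `(k ⋆ u)(x) - u(x) = ∫ k(h) (u(h⁻¹ x) - u(x)) dh`
  have hsub : haarConv k u x - u x =
      ∫ h, k h * (u (h⁻¹ * x) - u x) ∂haarProbability G := by
    rw [haarConv_apply]
    have h2 : u x = ∫ h, k h * u x ∂haarProbability G := by
      rw [integral_mul_const, hk_int, one_mul]
    conv_lhs => rw [h2]
    rw [← integral_sub (hint (by fun_prop)) (hint (by fun_prop))]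
    refine integral_congr_ae (ae_of_all _ fun h => ?_)
    ring
  rw [hsub]
  calc |∫ h, k h * (u (h⁻¹ * x) - u x) ∂haarProbability G|
      ≤ ∫ h, |k h * (u (h⁻¹ * x) - u x)| ∂haarProbability G := abs_integral_le_integral_abs
    _ ≤ ∫ h, k h * ε ∂haarProbability G := by
        refine integral_mono_of_nonneg (ae_of_all _ fun h => abs_nonneg _) (hint (by fun_prop))
          (ae_of_all _ fun h => ?_)
        show |k h * (u (h⁻¹ * x) - u x)| ≤ k h * ε
        rw [abs_mul, abs_of_nonneg (hk_nonneg h)]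
        by_cases hkh : k h = 0
        · rw [hkh, zero_mul, zero_mul]
        · refine mul_le_mul_of_nonneg_left (le_of_lt ?_) (hk_nonneg h)
          have hk₁h : k₁ h ≠ 0 := fun h0 => hkh (by rw [hk_apply, h0, mul_zero])
          have := hUε h⁻¹ (hk₁_supp h hk₁h) x
          exact this
    _ = ε := by rw [integral_mul_const, hk_int, one_mul]

/-! ### Eigenfunctions of a symmetric convolution operator -/

/-- An `L²` eigenvector of `T_k` with non-zero eigenvalue `c` has a continuous representative
`v` with `k ⋆ v = c v` pointwise (namely `v = c⁻¹ (k ⋆ f)`). [folklore] -/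
theorem exists_continuous_eigenfunction (k : C(G, ℝ)) {c : ℝ} (hc : c ≠ 0)
    {f : Lp ℝ 2 (haarProbability G)} (hf : convL2 k.continuous f = c • f) :
    ∃ v : C(G, ℝ), ContinuousMap.toLp 2 (haarProbability G) ℝ v = f ∧
      ∀ x, haarConv k v x = c * v x := by
  set v : C(G, ℝ) := c⁻¹ • convToCM k.continuous f with hv
  have hvf : ContinuousMap.toLp 2 (haarProbability G) ℝ v = f := by
    rw [hv, map_smul]
    change c⁻¹ • convL2 k.continuous f = f
    rw [hf, smul_smul, inv_mul_cancel₀ hc, one_smul]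
  refine ⟨v, hvf, fun x => ?_⟩
  -- `k ⋆ v = k ⋆ f` (a.e. equal arguments) `= c v`
  have hae : (v : G → ℝ) =ᵐ[haarProbability G] f := by
    have h := ContinuousMap.coeFn_toLp (p := 2) (μ := haarProbability G) (𝕜 := ℝ) v
    rw [hvf] at h
    exact h.symm
  rw [haarConv_congr_ae k hae]
  change haarConv k f x = c * (c⁻¹ • convToCM k.continuous f) x
  rw [ContinuousMap.smul_apply, convToCM_apply, smul_eq_mul, ← mul_assoc, mul_inv_cancel₀ hc,
    one_mul]

/-- The `L²` pairing with a kernel translate is a value of the convolution: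
`⟪[h ↦ k (y h⁻¹)], f⟫ = (k ⋆ f)(y)`. [folklore] -/
theorem inner_toLp_kernel (k : C(G, ℝ)) (y : G) (f : Lp ℝ 2 (haarProbability G)) :
    ⟪ContinuousMap.toLp 2 (haarProbability G) ℝ
        (⟨fun h => k (y * h⁻¹), k.continuous.comp (continuous_const.mul continuous_inv)⟩ : C(G, ℝ)),
      f⟫_ℝ = haarConv k f y := by
  rw [haarConv_eq_integral_mul_inv, MeasureTheory.L2.inner_def]
  refine integral_congr_ae ?_
  filter_upwards [ContinuousMap.coeFn_toLp (p := 2) (μ := haarProbability G) (𝕜 := ℝ)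
    (⟨fun h => k (y * h⁻¹), k.continuous.comp (continuous_const.mul continuous_inv)⟩ : C(G, ℝ))]
    with h hh
  rw [hh]
  simp only [RCLike.inner_apply, conj_trivial, ContinuousMap.coe_mk, mul_comm]

/-- **Propagation of right invariance from eigenfunctions to all convolutions.**  Let `k` be a
continuous symmetric kernel and `g ∈ G`.  If every continuous eigenfunction `v` of `k ⋆ ·` with
non-zero eigenvalue is right-`g`-invariant (`v (x g) = v x`), then `(k ⋆ u)(x g) = (k ⋆ u)(x)`
for every continuous `u` and every `x`: the difference `d` of the kernel translates at `x g` and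
`x` is orthogonal to every eigenspace of the compact symmetric operator `T_k` (to the kernel of
`T_k` because `k ⋆ f = 0` there, to the others by the hypothesis), hence `d = 0` by the spectral
theorem, and `⟪d, u⟫ = (k ⋆ u)(x g) - (k ⋆ u)(x)`. [folklore] -/
theorem haarConv_mul_right_eq_of_forall_eigen [T2Space G] (k : C(G, ℝ)) (hks : ∀ y, k y⁻¹ = k y)
    (g : G)
    (H : ∀ c : ℝ, c ≠ 0 → ∀ v : C(G, ℝ), (∀ x, haarConv k v x = c * v x) → ∀ x, v (x * g) = v x)
    (u : C(G, ℝ)) (x : G) : haarConv k u (x * g) = haarConv k u x := by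
  set T := convL2 (G := G) k.continuous with hT
  have hTc : IsCompactOperator T := isCompactOperator_convL2 k.continuous
  have hTs : (T : Lp ℝ 2 (haarProbability G) →ₗ[ℝ] Lp ℝ 2 (haarProbability G)).IsSymmetric :=
    convL2_isSymmetric k.continuous hks
  -- the kernel translates
  let ky : G → C(G, ℝ) := fun y =>
    ⟨fun h => k (y * h⁻¹), k.continuous.comp (continuous_const.mul continuous_inv)⟩
  have hinner : ∀ (y : G) (f : Lp ℝ 2 (haarProbability G)),
      ⟪ContinuousMap.toLp 2 (haarProbability G) ℝ (ky y), f⟫_ℝ = haarConv k f y :=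
    fun y f => inner_toLp_kernel k y f
  set d : Lp ℝ 2 (haarProbability G) :=
    ContinuousMap.toLp 2 (haarProbability G) ℝ (ky (x * g)) -
      ContinuousMap.toLp 2 (haarProbability G) ℝ (ky x) with hd_def
  have hd : ∀ f : Lp ℝ 2 (haarProbability G), ⟪d, f⟫_ℝ = haarConv k f (x * g) - haarConv k f x :=
    fun f => by rw [hd_def, inner_sub_left, hinner, hinner]
  -- `d` is orthogonal to every eigenspace of `T`
  have horth : ∀ μ : ℝ, ∀ f ∈ Module.End.eigenspace (T : Module.End ℝ (Lp ℝ 2 (haarProbability G))) μ,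
      ⟪d, f⟫_ℝ = 0 := by
    intro μ f hf
    rw [Module.End.mem_eigenspace_iff] at hf
    change T f = μ • f at hf
    rw [hd]
    by_cases hμ : μ = 0
    · subst hμ
      rw [zero_smul] at hf
      have h0 : convToCM k.continuous f = 0 := by
        apply ContinuousMap.toLp_injective (haarProbability G) (p := 2) (𝕜 := ℝ)
        rw [map_zero]
        exact hf
      have h1 : ∀ y, haarConv k f y = 0 := fun y => by
        rw [← convToCM_apply k.continuous f y, h0]; rfl
      rw [h1, h1, sub_self]
    · obtain ⟨v, hvf, hv⟩ := exists_continuous_eigenfunction k hμ hf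
      have hae : (f : G → ℝ) =ᵐ[haarProbability G] v := by
        have h := ContinuousMap.coeFn_toLp (p := 2) (μ := haarProbability G) (𝕜 := ℝ) v
        rw [hvf] at h
        exact h
      rw [haarConv_congr_ae k hae, hv, hv, H μ hμ v hv x, sub_self]
  have hd0 : d = 0 := by
    have hmem : d ∈ (⨆ μ, Module.End.eigenspace
        (T : Module.End ℝ (Lp ℝ 2 (haarProbability G))) μ)ᗮ := by
      rw [← Submodule.iInf_orthogonal, Submodule.mem_iInf]
      intro μ
      rw [Submodule.mem_orthogonal']
      exact horth μ
    rw [ContinuousLinearMap.orthogonalComplement_iSup_eigenspaces_eq_bot hTc hTs] at hmem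
    exact (Submodule.mem_bot ℝ).1 hmem
  have h := hd (ContinuousMap.toLp 2 (haarProbability G) ℝ u)
  rw [hd0, inner_zero_left,
    haarConv_congr_ae k (ContinuousMap.coeFn_toLp (p := 2) (μ := haarProbability G) (𝕜 := ℝ) u)]
    at h
  linarith

/-- **Some continuous eigenfunction of some symmetric kernel moves under a given `g ≠ 1`.**
Otherwise, by `haarConv_mul_right_eq_of_forall_eigen`, `(k ⋆ u)(g) = (k ⋆ u)(1)` for every
continuous `u` and every symmetric kernel `k`, so `u g = u 1` by the approximate identity
(`exists_symm_kernel_haarConv_sub_le`), contradicting Urysohn's lemma. [folklore] -/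
theorem exists_eigenfunction_not_invariant [T2Space G] {g : G} (hg : g ≠ 1) :
    ∃ (k : C(G, ℝ)) (c : ℝ), c ≠ 0 ∧ ∃ v : C(G, ℝ), (∀ x, haarConv k v x = c * v x) ∧
      ∃ x, v (x * g) ≠ v x := by
  by_contra hcon
  push Not at hcon
  -- every continuous `u` satisfies `u g = u 1`
  have hall : ∀ u : C(G, ℝ), u g = u 1 := by
    intro u
    have hconv : ∀ (k : C(G, ℝ)), (∀ y, k y⁻¹ = k y) → haarConv k u g = haarConv k u 1 := by
      intro k hks
      have := haarConv_mul_right_eq_of_forall_eigen k hks g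
        (fun c hc v hv x => hcon k c hc v hv x) u 1
      rwa [one_mul] at this
    refine eq_of_forall_dist_le fun ε hε => ?_
    obtain ⟨k, hks, hk⟩ := exists_symm_kernel_haarConv_sub_le u (half_pos hε)
    rw [Real.dist_eq]
    have h1 := hk g
    have h2 := hk 1
    rw [hconv k hks] at h1
    calc |u g - u 1| = |(haarConv k u 1 - u 1) - (haarConv k u 1 - u g)| := by
          congr 1; ring
      _ ≤ |haarConv k u 1 - u 1| + |haarConv k u 1 - u g| := abs_sub _ _
      _ ≤ ε / 2 + ε / 2 := add_le_add h2 h1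
      _ = ε := by ring
  -- Urysohn: a continuous function with `u 1 = 0`, `u g = 1`
  obtain ⟨u, hu0, hu1, -⟩ := exists_continuous_zero_one_of_isClosed (isClosed_singleton (x := (1 : G)))
    (isClosed_singleton (x := g)) (disjoint_singleton.2 hg.symm)
  have := hall u
  rw [show u g = 1 from hu1 rfl, show u 1 = 0 from hu0 rfl] at this
  exact one_ne_zero this

/-- The continuous eigenfunctions `{v | k ⋆ v = c v}` (`c ≠ 0`) of a continuous kernel form a
finite-dimensional subspace of `C(G, ℝ)` (it embeds into the `L²` eigenspace of the compact
operator `T_k`), invariant under right translations. [folklore] -/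
theorem finiteDimensional_eigenfunctions (k : C(G, ℝ)) {c : ℝ} (hc : c ≠ 0) :
    ∃ W : Submodule ℝ C(G, ℝ), FiniteDimensional ℝ W ∧ (∀ a : G, ∀ v ∈ W, rTrans a v ∈ W) ∧
      ∀ v : C(G, ℝ), v ∈ W ↔ ∀ x, haarConv k v x = c * v x := by
  have hi : ∀ (v : C(G, ℝ)) (x : G),
      Integrable (fun h => k h * v (h⁻¹ * x)) (haarProbability G) := fun v x =>
    (show Continuous fun h => k h * v (h⁻¹ * x) by fun_prop).integrable_of_hasCompactSupport
      (HasCompactSupport.of_compactSpace _)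
  let W : Submodule ℝ C(G, ℝ) :=
    { carrier := {v | ∀ x, haarConv k v x = c * v x}
      add_mem' := fun {v w} hv hw x => by
        show haarConv k ⇑(v + w) x = c * (v + w) x
        rw [ContinuousMap.coe_add, haarConv_apply, Pi.add_apply, mul_add, ← hv x,
          ← hw x, haarConv_apply, haarConv_apply, ← integral_add (hi v x) (hi w x)]
        refine integral_congr_ae (ae_of_all _ fun h => ?_)
        simp only [Pi.add_apply, mul_add]
      zero_mem' := fun x => by
        show haarConv k ⇑(0 : C(G, ℝ)) x = c * (0 : C(G, ℝ)) x
        rw [ContinuousMap.coe_zero, haarConv_apply]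
        simp
      smul_mem' := fun r v hv x => by
        show haarConv k ⇑(r • v) x = c * (r • v) x
        rw [ContinuousMap.coe_smul, haarConv_apply, Pi.smul_apply, smul_eq_mul,
          mul_left_comm, ← hv x, haarConv_apply, ← integral_const_mul]
        refine integral_congr_ae (ae_of_all _ fun h => ?_)
        simp only [Pi.smul_apply, smul_eq_mul]
        ring }
  refine ⟨W, ?_, fun a v hv x => ?_, fun v => Iff.rfl⟩
  · -- `W` embeds linearly into the finite-dimensional `L²` eigenspace
    set T := convL2 (G := G) k.continuous
    haveI : FiniteDimensional ℝ (Module.End.eigenspace (T : Module.End ℝ (Lp ℝ 2 (haarProbability G))) c) :=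
      ContinuousLinearMap.finite_dimensional_eigenspace (isCompactOperator_convL2 k.continuous) c hc
    let φ : W →ₗ[ℝ] Module.End.eigenspace (T : Module.End ℝ (Lp ℝ 2 (haarProbability G))) c :=
      { toFun := fun v => ⟨ContinuousMap.toLp 2 (haarProbability G) ℝ (v : C(G, ℝ)), by
          rw [Module.End.mem_eigenspace_iff]
          change convL2 k.continuous _ = _
          rw [convL2_toLp, ← map_smul]
          congr 1
          ext x
          exact (v.2 x).trans (by rw [ContinuousMap.smul_apply, smul_eq_mul])⟩
        map_add' := fun v w => by ext1; simp
        map_smul' := fun r v => by ext1; simp }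
    have hφ : Function.Injective φ := by
      intro v w h
      have h' : ContinuousMap.toLp 2 (haarProbability G) ℝ (v : C(G, ℝ)) =
          ContinuousMap.toLp 2 (haarProbability G) ℝ (w : C(G, ℝ)) := congrArg Subtype.val h
      exact Subtype.ext (ContinuousMap.toLp_injective (haarProbability G) h')
    exact Module.Finite.of_injective φ hφ
  · -- right invariance
    show haarConv k (rTrans a v) x = c * rTrans a v x
    rw [rTrans_apply, ← hv (x * a), ← haarConv_comp_mul_right k v a x]
    rfl

end Haar

/-! ### Matrix representations on invariant finite-dimensional subspaces -/

/-- **The representation on a right-invariant finite-dimensional subspace of `C(G, ℝ)`.**  If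
`W ⊆ C(G, ℝ)` is finite-dimensional and invariant under all right translations `R_a`, the
matrices of `R_a|_W` in a basis (complexified) form a continuous representation
`ρ : G →* M_n(ℂ)`, and `ρ g = 1` forces `R_g v = v` for all `v ∈ W`. [folklore] -/
theorem exists_rep_of_invariant_subspace [T2Space G] (W : Submodule ℝ C(G, ℝ))
    [FiniteDimensional ℝ W] (hW : ∀ a : G, ∀ v ∈ W, rTrans a v ∈ W) :
    ∃ (n : ℕ) (ρ : G →* Matrix (Fin n) (Fin n) ℂ), Continuous ρ ∧
      ∀ g : G, ρ g = 1 → ∀ v ∈ W, rTrans g v = v := by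
  classical
  -- the representation on `W`
  let π : G →* Module.End ℝ W :=
    { toFun := fun a => (rTrans a).toLinearMap.restrict (hW a)
      map_one' := by
        ext v x
        simp [LinearMap.restrict_apply]
      map_mul' := fun a b => by
        ext v x
        simp [LinearMap.restrict_apply, rTrans_apply, mul_assoc] }
  have hπ : ∀ (a : G) (v : W), (π a v : C(G, ℝ)) = rTrans a v := fun a v => rfl
  -- matrices in a basis
  set n := Module.finrank ℝ W
  let b := Module.finBasis ℝ W
  let M : G →* Matrix (Fin n) (Fin n) ℝ :=
    { toFun := fun a => LinearMap.toMatrix b b (π a)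
      map_one' := by rw [map_one, LinearMap.toMatrix_one]
      map_mul' := fun a a' => by rw [map_mul, LinearMap.toMatrix_mul] }
  let ρ : G →* Matrix (Fin n) (Fin n) ℂ :=
    ((algebraMap ℝ ℂ).mapMatrix : Matrix (Fin n) (Fin n) ℝ →+* Matrix (Fin n) (Fin n) ℂ).toMonoidHom.comp M
  have hρ : ∀ a, ρ a = (LinearMap.toMatrix b b (π a)).map (algebraMap ℝ ℂ) := fun a => rfl
  -- continuity
  have hMc : Continuous fun a => LinearMap.toMatrix b b (π a) := by
    refine continuous_pi fun i => continuous_pi fun j => ?_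
    simp only [LinearMap.toMatrix_apply]
    have h1 : Continuous fun a : G => π a (b j) := by
      have : Continuous fun a : G => (rTrans a (b j : C(G, ℝ)) : C(G, ℝ)) :=
        continuous_rTrans_apply _
      exact this.subtype_mk fun a => hW a _ (b j).2
    exact ((b.coord i).continuous_of_finiteDimensional).comp h1
  have hρc : Continuous ρ := by
    have : (ρ : G → Matrix (Fin n) (Fin n) ℂ) =
        fun a => (LinearMap.toMatrix b b (π a)).map (algebraMap ℝ ℂ) := funext hρ
    rw [this]
    exact continuous_pi fun i => continuous_pi fun j =>
      Complex.continuous_ofReal.comp ((continuous_apply j).comp ((continuous_apply i).comp hMc))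
  refine ⟨n, ρ, hρc, fun g hg v hv => ?_⟩
  -- `ρ g = 1 ⟹ π g = 1 ⟹ R_g v = v`
  have h1 : LinearMap.toMatrix b b (π g) = 1 := by
    apply Matrix.map_injective (RingHom.injective (algebraMap ℝ ℂ))
    show (LinearMap.toMatrix b b (π g)).map (algebraMap ℝ ℂ) =
      (1 : Matrix (Fin n) (Fin n) ℝ).map (algebraMap ℝ ℂ)
    rw [← hρ, hg, Matrix.map_one _ (map_zero _) (map_one _)]
  have h2 : π g = 1 := by
    rw [← LinearMap.toMatrix_one b] at h1
    exact (LinearMap.toMatrix b b).injective h1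
  have h3 := congrArg (fun T : Module.End ℝ W => (T ⟨v, hv⟩ : C(G, ℝ))) h2
  simpa [hπ] using h3

/-! ### The theorem -/

/-- **Peter–Weyl (point separation by finite-dimensional unitary representations).**  For a
compact Hausdorff group `G` and `g ≠ 1` there is a continuous unitary matrix representation
`σ : G →* U(n)` with `σ g ≠ 1` (Bröcker–tom Dieck III (3.1) with (4.1); Folland Thm. 5.11):
some continuous eigenfunction of a symmetric convolution operator is moved by `R_g`
(`exists_eigenfunction_not_invariant`), the eigenfunctions span a finite-dimensional
right-invariant subspace (`finiteDimensional_eigenfunctions`) carrying a continuous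
representation non-trivial at `g` (`exists_rep_of_invariant_subspace`), which is conjugate to a
unitary one (Weyl's trick, `unitarize`). [cite: BrockerTomDieck1985, III (3.1), (4.1)] -/
theorem exists_unitary_rep_apply_ne_one [T2Space G] {g : G} (hg : g ≠ 1) :
    ∃ (n : ℕ) (σ : G →* Matrix (Fin n) (Fin n) ℂ), Continuous σ ∧
      (∀ x, σ x ∈ Matrix.unitaryGroup (Fin n) ℂ) ∧ σ g ≠ 1 := by
  classical
  letI : MeasurableSpace G := borel G
  haveI : BorelSpace G := ⟨rfl⟩
  obtain ⟨k, c, hc, v, hv, x, hx⟩ := exists_eigenfunction_not_invariant (G := G) hg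
  obtain ⟨W, hWfd, hWinv, hWmem⟩ := finiteDimensional_eigenfunctions (G := G) k hc
  haveI := hWfd
  obtain ⟨n, ρ, hρc, hρ⟩ := exists_rep_of_invariant_subspace W hWinv
  have hρg : ρ g ≠ 1 := by
    intro h
    have := hρ g h v ((hWmem v).2 hv)
    exact hx (by rw [← rTrans_apply g v x, this])
  refine ⟨n, CompactGroup.unitarize ρ hρc, CompactGroup.continuous_unitarize ρ hρc,
    CompactGroup.unitarize_mem_unitaryGroup ρ hρc, fun h => hρg ?_⟩
  have hB := CompactGroup.isUnit_det_unitarizer ρ hρc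
  have key : ρ g = (CompactGroup.unitarizer ρ hρc)⁻¹ * CompactGroup.unitarize ρ hρc g *
      CompactGroup.unitarizer ρ hρc := by
    rw [CompactGroup.unitarize_apply,
      show (CompactGroup.unitarizer ρ hρc)⁻¹ * (CompactGroup.unitarizer ρ hρc * ρ g *
        (CompactGroup.unitarizer ρ hρc)⁻¹) * CompactGroup.unitarizer ρ hρc =
        ((CompactGroup.unitarizer ρ hρc)⁻¹ * CompactGroup.unitarizer ρ hρc) * ρ g *
        ((CompactGroup.unitarizer ρ hρc)⁻¹ * CompactGroup.unitarizer ρ hρc) by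
          simp only [Matrix.mul_assoc],
      Matrix.nonsing_inv_mul _ hB, Matrix.one_mul, Matrix.mul_one]
  rw [key, h, Matrix.mul_one, Matrix.nonsing_inv_mul _ hB]

end PeterWeyl

end Literature.RepresentationTheory.CompactGroups
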